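import Summits.BirchSwinnertonDyer.BirchSwinnertonDyer.Theorems.SchneiderFreeAdditiveX3SemistableTwistLocalAnyLine
import Summits.BirchSwinnertonDyer.BirchSwinnertonDyer.Theorems.SchneiderFreeAdditiveX3KYMuZeroOfPrintFiveLe
import Summits.BirchSwinnertonDyer.BirchSwinnertonDyer.Theorems.EisensteinPrimesXAcImprimitiveNoPTorsion
import HarnessLib

/-!
# Route `SchneiderFreeAdditiveX3` (K1 door): the ALGEBRAIC λ-clause of Keller–Yin 2410.23241 §3.5 at `p ≥ 5` —
# PART 1: the local data of every `Γ_K`-stable line of `E_K[p]` and Keller–Yin 2024 Thm. 1.4.1's count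
# `λ(𝔛^{Sf}(E_K)) ≤ λ(𝔛^{Sf}_{Gr}(θsub)) + λ(𝔛^{Sf}_{Gr}(θquot))` (`=` granted no `p`-torsion) for the door's curves,
# IN THE KERNEL modulo CGLS 2022 Prop. 1.2.5 + Cor. 1.2.6 [PUB], by porting cell `bsd-eis`'s count to the semistable-twist datum

Cell `bsd-schneider-ideate`, seat `bsd-schneider-door-c5` (prover, generation 24; assembly layer; `--supports` 19177).
PARTITION: board row B6 ∩ X3 ∩ sst-twist, `r = 1` (7 101 pairs; (G-ord, `e = 2`) half 2 560, (M) half 4 541), at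
`p ≥ 5`; types-the-object-of nothing new; DERIVES the algebraic half of the `λ`-clause [INV.λ] of crux r3's preprint
input in imprimitive currency; closes none of B6's cells (BSD NOT advanced).  bears_on: K1-door (items 18971/18972 →
19177 r3 `GordTwoBranchIMC`) + K1-wing (20365).

## Why

Keller–Yin (arXiv:2410.23241) Thm. 3.5.1, first sentence — "`μ(𝔛) = μ(𝓛_ε) = 0` and `λ(𝔛) = λ(𝓛_ε)`" — is the
Greenberg–Vatsal half [INV] of the door's one preprint input (`KellerYin2024.thm351_invariants_branch_OPEN`).  Its
printed proof [p0020:L3]: "the analysis on the algebraic side is exactly as in [KY24]", i.e. Keller–Yin 2402.12781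
Thm. 1.4.1 / CGLS 2022 Props. 1.4.1–1.4.2: `λ(𝔛^S_f) = λ(𝔛^S_φ) + λ(𝔛^S_ψ)` for the residual characters `φ = φ′ε`,
`ψ = ψ′ε` of `E[p]` (`E = V ⊗ χ_{p*}`, `ρ̄_V ∼ (φ′ *; 0 ψ′)`).  Generation 23 derived the `μ`-part ([INV.μ]) and the
torsion clause in the kernel.  Cell `bsd-eis` (width seat `bsd-line-x2-p2`, generations 6–7, 2026-08-28) built the
λ-COUNT itself in the kernel modulo PUBLISHED character-level and Λ-module facts, REDUCTION-TYPE-FREE except for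
the discharge of CGLS's local hypothesis "both residual characters avoid `{𝟙, ω}` at `v̄`", which it did at a
NON-SPLIT multiplicative prime (`…ResidualDevissageNonsplitLambdaIdentityOfFacts.lambdaInvariant_le_add_of_isResidualPairOver`,
`…XAcImprimitiveNoPTorsion.xAc_smul_eq_zero_imp_of_facts`).  For the door's curves — additive at `p` with a
semistable twist `E^{(p*)}` — the Jordan–Hölder characters of `E[p]|_{I_p}` are `ω^{(p±1)/2}`, neither `𝟙` nor `ω`
once `p ≥ 5` (generation 23's `…SemistableTwistLocalNonAnomalous`, upgraded to every line of `E[p]` in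
`…SemistableTwistLocalAnyLine`).  This file performs the port.

## What

* §1 `localData_of_nonAnomalous` — REDUCTION-TYPE-FREE: for `W/ℚ`, `K` imaginary quadratic with `(p)` split,
  `v̄ ∋ p`, any `ℤ_p`-extension `κ`, GIVEN the non-anomalous clause for every order-`p` subgroup of `E[p]` at every
  `𝔓 ∣ p` (hypothesis `hna`), EVERY `Γ_K`-stable line `S ≤ E_K[p]` carries CGLS's local data at `v̄` (`#(E_K[p]/S) = p`;
  `D_{v̄}` fixes neither `S` nor `E_K[p]/S` pointwise and acts on neither through `ω`; no `(ker κ ⊓ D_{v̄})`-fixed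
  vector in `E_K[p]/S`) — `bsd-eis`'s `localData_of_not_split` with its Tate-curve step replaced by `hna`;
  `localData_of_classX3_of_subSemistableTwist` — the cells at `p ≥ 5`.
* §2 `lambdaInvariant_le_add_of_isResidualPairOver_of_nonAnomalous` — at every Heegner datum (`K` Heegner for
  `N_W`, `(p)` split, `κ` anticyclotomic, `Sf` = places over `N_W` off `p`) with `hna`, for EVERY residual pair
  `(θsub, θquot)` of `E_K[p]` and all strict dual data: `p^{λ(𝔛^{Sf})}·#𝔛^{Sf}[p] = p^{λ(Dsub.X)+λ(Dquot.X)}`,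
  `λ(𝔛^{Sf}) ≤ λ(Dsub.X) + λ(Dquot.X)`, `=` if `𝔛^{Sf}` has no `p`-torsion — modulo CGLS22 Prop. 1.2.5 + Cor. 1.2.6 [PUB];
  `…_of_classX3_of_subSemistableTwist` — the cells at `p ≥ 5`.
* PART 2 (`…KYLambdaAlgImprimitiveEqOfPrintFiveLe`): §3 `𝔛^{Sf}` f.g., `Λ`-torsion, `μ = 0` from CGLS22 Prop. 14 [PUB]
  and §4 the EQUALITY `λ(𝔛^{Sf}(E_K)) = λ(Dsub.X) + λ(Dquot.X)` modulo the eight published facts of `bsd-eis`'s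
  `lambdaInvariant_xAc_eq_add_of_not_split_of_facts` — Keller–Yin 2410.23241 §3.5's "the analysis on the algebraic side
  is exactly as in [KY24]" AS OUR THEOREM at `p ≥ 5` on both semistable-twist cells (imprimitive currency `Sf`; the
  door's `𝔛 = X_ac^∅` differs from `𝔛^{Sf}` by the local λ-shift, not done here).

HONEST FRAMING: compositions of tree theorems, CONDITIONAL BY NAME on published facts typed as `Prop`s (not proved in
the tree); no definition, no named fact introduced, no `sorry`; the ANALYTIC λ (`λ(𝓛_ε)`: Kriz/CGLS-type descent for
`f̃ ⊗ ε`, Katz, Hida, Rubin) is NOT touched and stays the preprint's; nothing at `p = 3` (anomalous characters);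
nothing about BSD or a main conjecture is asserted; «closes rung: none».
References: Keller–Yin arXiv:2410.23241 §3.5, Thm. 3.5.1 [KellerYin2024b]; Keller–Yin arXiv:2402.12781 Thm. 1.4.1, §1.4
[KellerYin2024]; Castella–Grossi–Lee–Skinner, Invent. Math. 227 (2022) §1.2 Prop. 1.2.5, Cor. 1.2.6, Prop. 14, §1.4
Props. 1.4.1–1.4.2, Cor. 1.4.3 [CastellaGrossiLeeSkinner2022]; Greenberg 2016 Prop. 4.1.1 [Greenberg2016Selmer]; Greenberg
2006 Props. 3.2, 4.1, 4.2 [Greenberg2006]; Greenberg–Vatsal 2000 §2 [GreenbergVatsal2000]; cell `bsd-eis` p649247,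
p654300 (the non-split twins); this seat p663074, p663835 (generation 23).
-/

set_option autoImplicit false
set_option linter.dupNamespace false -- the summit namespace `…BirchSwinnertonDyer.BirchSwinnertonDyer.Theorems` (Sub = Summit, D-0017) trips it

noncomputable section

open scoped Classical Pointwise

namespace Summit.BirchSwinnertonDyer.BirchSwinnertonDyer.Theorems.SchneiderFreeAdditiveX3.KYLambdaAlg

open WeierstrassCurve NumberField IsDedekindDomain Field
  Literature.NumberTheory.EllipticCurves Literature.NumberTheory.EllipticCurves.IwasawaAlgebra
  Literature.NumberTheory.EllipticCurves.GreenbergSelmer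
  Literature.NumberTheory.EllipticCurves.GreenbergVatsal2000
  Literature.NumberTheory.GaloisRepresentations IsDedekindDomain.HeightOneSpectrum
  Literature.NumberTheory.EllipticCurves.Rank1Residual Literature.NumberTheory.EllipticCurves.KellerYin2024
  Literature.NumberTheory.EllipticCurves.IwasawaDual Literature.NumberTheory.EllipticCurves.Castella2018.AcSelmer
  Literature.NumberTheory.IwasawaTheory Literature.NumberTheory.IwasawaTheory.Greenberg2016
  Literature.NumberTheory.IwasawaTheory.Greenberg2006
  Summit.BirchSwinnertonDyer.Rank1Residual Summit.BirchSwinnertonDyer.Rank1Residual.Additive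
  Summit.BirchSwinnertonDyer.Rank1Residual.X2.ResidualDevissageModules
  Summit.BirchSwinnertonDyer.BirchSwinnertonDyer.Theorems
  Summit.BirchSwinnertonDyer.BirchSwinnertonDyer.Theorems.ResidualDevissageNonsplitLocalData
  Summit.BirchSwinnertonDyer.BirchSwinnertonDyer.Theorems.ResidualDevissageNonsplitLambdaIdentityOfFacts
  Summit.BirchSwinnertonDyer.BirchSwinnertonDyer.Theorems.CumulativeHeegnerInclusionAtThreeResidualDevissage
  Summit.BirchSwinnertonDyer.BirchSwinnertonDyer.Theorems.CumulativeHeegnerInclusionAtThreeLineBaseChange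
  Summit.BirchSwinnertonDyer.BirchSwinnertonDyer.Theorems.CumulativeHeegnerInclusionAtThreeTowerFixed
  Summit.BirchSwinnertonDyer.BirchSwinnertonDyer.Theorems.CumulativeHeegnerInclusionAtThreeStubB1LineDeterminant
  Summit.BirchSwinnertonDyer.BirchSwinnertonDyer.Theorems.CumulativeHeegnerInclusionAtThreeBadPlaces
  Summit.BirchSwinnertonDyer.BirchSwinnertonDyer.Theorems.AdditiveKoly.SplitCompletion
  Summit.BirchSwinnertonDyer.BirchSwinnertonDyer.Theorems.KellerYinLemma511NonsplitOfPrint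
  Summit.BirchSwinnertonDyer.BirchSwinnertonDyer.Theorems.SchneiderFreeAdditiveX3
open Literature.NumberTheory.EllipticCurves.CastellaGrossiLeeSkinner2022
  (cor126_residualCharacter_globalLift cor126_residualCharacter_localSurjective
    prop125_characterGrSelmerDual_torsion_muZero_dim prop14_residualCharacterSelmer_finite)

/-! ### §1 The local data at `v̄` of ANY `Γ_K`-stable line of `E_K[p]`, from the non-anomalous clause over `ℚ` -/

/-- **Every `Γ_K`-stable line of `E_K[p]` carries the CGLS local data at `v̄`, GIVEN the non-anomalous clause for every
order-`p` subgroup of `E[p]` at every prime above `p`** (`K` imaginary quadratic, `(p)` split, `v̄ ∋ p`, any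
`ℤ_p`-extension `κ`; `S ≤ E_K[p]` any `Γ_K`-stable subgroup of order `p`): `#(E_K[p]/S) = p`; `D_{v̄}` fixes neither `S`
nor `E_K[p]/S` pointwise; `D_{v̄}` acts on neither through the mod-`p` cyclotomic character; `E_K[p]/S` has no non-zero
`(ker κ ⊓ D_{v̄})`-fixed vector.  REDUCTION-TYPE-FREE: cell `bsd-eis`'s `localData_of_not_split` (p649247) VERBATIM with
its Tate-curve step replaced by the hypothesis `hna` — the clause for the line `t⁻¹(S) ≤ E[p](ℚ̄)` along an
equivariant `t : E[p](ℚ̄) ≅ E_K[p](K̄)`, CHL's degree-one transport to `D_{v̄}`, the Weil pairing (`det = ω`) for the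
cyclotomic clauses. [cite: CastellaGrossiLeeSkinner2022, §1.2 (hypothesis θ|_{G_v̄} ≠ 𝟙, ω), §1.4]
[cite: NeukirchANT1999, Ch. I §9 Prop. (9.4)–(9.6)] -/
theorem localData_of_nonAnomalous
    {p : ℕ} [hp : Fact p.Prime] (W : WeierstrassCurve ℚ) [W.IsElliptic]
    (K : Type) [Field K] [NumberField K] (vbar : HeightOneSpectrum (𝓞 K)) (κ : ZpExtension K p)
    (hK : IsImaginaryQuadratic K)
    (hsplit : ((Ideal.span {(p : ℤ)}).primesOver (𝓞 K)).ncard = 2)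
    (hvbar : ((p : ℕ) : 𝓞 K) ∈ vbar.asIdeal)
    (hna : ∀ (v : HeightOneSpectrum (𝓞 ℚ)), ((p : ℕ) : 𝓞 ℚ) ∈ v.asIdeal →
      ∀ (Φ : AddSubgroup (geomTorsion W (p : ℤ))), Nat.card Φ = p →
      ∀ 𝔓 ∈ v.primesAbove,
        (¬ ∀ g ∈ 𝔓.decompositionSubgroup (absoluteGaloisGroup ℚ), ∀ P ∈ Φ, g • P = P) ∧
          (¬ ∀ g ∈ 𝔓.decompositionSubgroup (absoluteGaloisGroup ℚ),
            ∀ P : geomTorsion W (p : ℤ), g • P - P ∈ Φ))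
    (S : StableSubgroup (absoluteGaloisGroup K) ((W.baseChange K).geomTorsion ((p : ℕ) : ℤ)))
    (hSub : Nat.card S.Sub = p) :
    Nat.card S.Quot = p ∧
      (¬ ∀ g ∈ decomp vbar, ∀ x : S.Sub, g • x = x) ∧
      (¬ ∀ g ∈ decomp vbar, ∀ y : S.Quot, g • y = y) ∧
      (¬ ∀ g ∈ decomp vbar, ∀ m : S.Sub,
        g • m = ((modNCyclotomicCharacter K p g : (ZMod p)ˣ) : ZMod p).val • m) ∧
      (¬ ∀ g ∈ decomp vbar, ∀ m : S.Quot,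
        g • m = ((modNCyclotomicCharacter K p g : (ZMod p)ˣ) : ZMod p).val • m) ∧
      (∀ y : S.Quot, (∀ g : ↥(κ.kerSubgroup ⊓ decomp vbar), g • y = y) → y = 0) := by
  have hpp : p.Prime := hp.out
  haveI hEK : (W.baseChange K).IsElliptic := inferInstanceAs (W.map (algebraMap ℚ K)).IsElliptic
  haveI : IsGalois ℚ K := isGalois_of_finrank_eq_two K hK.1
  have he : vbar.asIdeal.ramificationIdx (𝓞 ℚ) = 1 :=
    ramificationIdx_eq_one_of_card_primesOver K p hK.1 hsplit vbar hvbar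
  have hf : vbar.asIdeal.inertiaDeg (𝓞 ℚ) = 1 :=
    inertiaDeg_eq_one_of_card_primesOver K p hK.1 hsplit vbar hvbar
  set v : HeightOneSpectrum (𝓞 ℚ) := vbar.under (𝓞 ℚ) with hv
  have hw : vbar.asIdeal.under (𝓞 ℚ) = v.asIdeal := by rw [hv, HeightOneSpectrum.under_asIdeal]
  have hpv : ((p : ℕ) : 𝓞 ℚ) ∈ v.asIdeal := natCast_mem_under K p vbar hvbar
  -- the line `Φ = t⁻¹(S)` over `ℚ̄`
  obtain ⟨t, ht⟩ := exists_geomTorsion_baseChange_equiv W K ((p : ℕ) : ℤ)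
  have ht' : ∀ (σ : absoluteGaloisGroup K) (P : W.geomTorsion ((p : ℕ) : ℤ)),
      t (absGaloisRestrict ℚ K σ • P) = σ • t P := fun σ P ↦ by
    rw [← resGal_eq_absGaloisRestrict]; exact ht σ P
  let Φ : AddSubgroup (W.geomTorsion ((p : ℕ) : ℤ)) := S.toAddSubgroup.comap t.toAddMonoidHom
  have hS : ∀ Q : (W.baseChange K).geomTorsion ((p : ℕ) : ℤ), Q ∈ S.toAddSubgroup ↔ t.symm Q ∈ Φ := fun Q ↦ by
    change Q ∈ S.toAddSubgroup ↔ t (t.symm Q) ∈ S.toAddSubgroup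
    rw [t.apply_symm_apply]
  have hΦcard : Nat.card Φ = p := by
    have e : Φ ≃ S.toAddSubgroup :=
      { toFun := fun x ↦ ⟨t x.1, x.2⟩
        invFun := fun y ↦ ⟨t.symm y.1, by
          change t (t.symm y.1) ∈ S.toAddSubgroup
          rw [t.apply_symm_apply]; exact y.2⟩
        left_inv := fun x ↦ Subtype.ext (t.symm_apply_apply x.1)
        right_inv := fun y ↦ Subtype.ext (t.apply_symm_apply y.1) }
    have h : Nat.card Φ = Nat.card S.Sub := Nat.card_congr e
    exact h.trans hSub
  have hcell : ∀ 𝔓 ∈ v.primesAbove,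
      (¬ ∀ g ∈ 𝔓.decompositionSubgroup (absoluteGaloisGroup ℚ), ∀ P ∈ Φ, g • P = P) ∧
        (¬ ∀ g ∈ 𝔓.decompositionSubgroup (absoluteGaloisGroup ℚ),
          ∀ P : geomTorsion W (p : ℤ), g • P - P ∈ Φ) :=
    fun 𝔓 h𝔓 ↦ hna v hpv Φ hΦcard 𝔓 h𝔓
  have hEp : Nat.card ((W.baseChange K).geomTorsion ((p : ℕ) : ℤ)) = p ^ 2 :=
    (W.baseChange K).natCard_geomTorsion_prime_eq_sq hpp
  have hQuot : Nat.card S.Quot = p := by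
    have h := S.natCard_eq_mul
    rw [hEp, hSub, sq] at h
    exact (Nat.eq_of_mul_eq_mul_right hpp.pos h).symm
  have hnon1 : ¬ ∀ γ ∈ decomp vbar, ∀ x : S.Sub, γ • x = x :=
    not_forall_decomp_smul_sub_eq_of_corr Φ t ht' S hS
      (not_forall_decomp_smul_eq K Φ hw he hf fun 𝔓 h𝔓 ↦ (hcell 𝔓 h𝔓).1)
  have hnon2 : ¬ ∀ γ ∈ decomp vbar, ∀ y : S.Quot, γ • y = y :=
    not_forall_decomp_smul_quot_eq_of_corr Φ t ht' S hS
      (not_forall_decomp_smul_sub_mem K Φ hw he hf fun 𝔓 h𝔓 ↦ (hcell 𝔓 h𝔓).2)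
  exact ⟨hQuot, hnon1, hnon2, not_forall_smul_sub_eq_cyclotomic (W.baseChange K) p S hSub (decomp vbar) hnon2,
    not_forall_smul_quot_eq_cyclotomic (W.baseChange K) p S hSub (decomp vbar) hnon1,
    eq_zero_of_fixed_of_not_forall_decomp_smul_eq κ vbar hQuot hnon2⟩

/-- **The semistable-twist cells of B6 ∩ X3 at `p ≥ 5`: every `Γ_K`-stable line of `E_K[p]` carries the CGLS local data at
`v̄`** — §1 with `hna` supplied by `SemistableTwistLocalAnyLine.not_fix_and_not_quot_of_classX3_of_subSemistableTwist_of_card_eq`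
(generation 23's inertia characters `ω^{(p±1)/2}`, this generation's plane algebra). [cite: Serre1972, §1.11 Prop. 11 and §1.12 Prop. 13]
[cite: SilvermanAEC2009, X.5 Cor. 5.4] [cite: CastellaGrossiLeeSkinner2022, §1.2 (hypothesis θ|_{G_v̄} ≠ 𝟙, ω)] -/
theorem localData_of_classX3_of_subSemistableTwist
    {p : ℕ} [Fact p.Prime] (W : WeierstrassCurve ℚ) [W.IsElliptic] [W.IsGloballyMinimal]
    (K : Type) [Field K] [NumberField K] (vbar : HeightOneSpectrum (𝓞 K)) (κ : ZpExtension K p)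
    (hp5 : 5 ≤ p) (hX : ClassX3 W p) (hSST : SubSemistableTwist W p) (hK : IsImaginaryQuadratic K)
    (hsplit : ((Ideal.span {(p : ℤ)}).primesOver (𝓞 K)).ncard = 2)
    (hvbar : ((p : ℕ) : 𝓞 K) ∈ vbar.asIdeal)
    (S : StableSubgroup (absoluteGaloisGroup K) ((W.baseChange K).geomTorsion ((p : ℕ) : ℤ)))
    (hSub : Nat.card S.Sub = p) :
    Nat.card S.Quot = p ∧
      (¬ ∀ g ∈ decomp vbar, ∀ x : S.Sub, g • x = x) ∧
      (¬ ∀ g ∈ decomp vbar, ∀ y : S.Quot, g • y = y) ∧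
      (¬ ∀ g ∈ decomp vbar, ∀ m : S.Sub,
        g • m = ((modNCyclotomicCharacter K p g : (ZMod p)ˣ) : ZMod p).val • m) ∧
      (¬ ∀ g ∈ decomp vbar, ∀ m : S.Quot,
        g • m = ((modNCyclotomicCharacter K p g : (ZMod p)ˣ) : ZMod p).val • m) ∧
      (∀ y : S.Quot, (∀ g : ↥(κ.kerSubgroup ⊓ decomp vbar), g • y = y) → y = 0) :=
  localData_of_nonAnomalous W K vbar κ hK hsplit hvbar
    (fun _ hpv _ hΦ _ h𝔓 ↦
      SemistableTwistLocalAnyLine.not_fix_and_not_quot_of_classX3_of_subSemistableTwist_of_card_eq W p hp5 hX hSST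
        hpv h𝔓 hΦ)
    S hSub

/-! ### §2 Keller–Yin Thm. 1.4.1's λ-relation for EVERY residual pair, from the non-anomalous clause -/

/-- **At every Eisenstein Heegner datum satisfying the non-anomalous clause `hna` and EVERY residual pair `(θsub, θquot)`
of `E_K[p]`: CGLS22 Prop. 1.2.5 + Cor. 1.2.6 [PUBLISHED] ⟹ `p^{λ(𝔛^{Sf})}·#𝔛^{Sf}[p] = p^{λ(𝔛_sub) + λ(𝔛_quot)}`,
`λ(𝔛^{Sf}) ≤ λ(𝔛_sub) + λ(𝔛_quot)`, and `=` if `𝔛^{Sf}` has no `p`-torsion.**  Binders: `W/ℚ`, `2 < p`, `K` imaginary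
quadratic with the Heegner hypothesis for `N_W` and `(p)` split, `v̄ ∋ p` the strict place, `κ` anticyclotomic with
topological generator `γ`, `Sf` = the places of `K` over `N_W` off `p`; `𝔛^{Sf} = AcSelmer.XAc E_K p κ v̄ ↑Sf γ`;
`𝔛_sub = Dsub.X`, `𝔛_quot = Dquot.X` ANY strict dual data (`KellerYin2024.GrDualData`) — CGLS's `𝔛^S_φ`, `𝔛^S_ψ`.
REDUCTION-TYPE-FREE: cell `bsd-eis`'s `lambdaInvariant_le_add_of_isResidualPairOver_of_not_split` with its four local
hypotheses DISCHARGED by §1 instead of the Tate curve. [cite: KellerYin2024, Thm. 1.4.1 (arXiv:2402.12781v2 TeX L1087–1098)]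
[cite: CastellaGrossiLeeSkinner2022, §1.2 Prop. 1.2.5, Cor. 1.2.6, §1.4 Props. 1.4.1–1.4.2, Cor. 1.4.3 (e-print TeX L681–905)] -/
theorem lambdaInvariant_le_add_of_isResidualPairOver_of_nonAnomalous
    (hprop125 : prop125_characterGrSelmerDual_torsion_muZero_dim)
    (hlift : cor126_residualCharacter_globalLift) (hlocal : cor126_residualCharacter_localSurjective)
    {p : ℕ} [Fact p.Prime] (W : WeierstrassCurve ℚ) [W.IsElliptic]
    (K : Type) [Field K] [NumberField K] (vbar : HeightOneSpectrum (𝓞 K))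
    (κ : ZpExtension K p) (γ : absoluteGaloisGroup K) [Fact (κ.IsTopGenerator γ)]
    (Sf : Finset (HeightOneSpectrum (𝓞 K)))
    (hp2 : 2 < p) (hK : IsImaginaryQuadratic K) (hH : SatisfiesHeegnerHypothesis (W.conductorNorm ℤ) K)
    (hsplit : ((Ideal.span {(p : ℤ)}).primesOver (𝓞 K)).ncard = 2)
    (hvbar : ((p : ℕ) : 𝓞 K) ∈ vbar.asIdeal) (hκ : κ.IsAnticyclotomic)
    (hSf : ∀ w : HeightOneSpectrum (𝓞 K), w ∈ Sf ↔
      (((W.conductorNorm ℤ : ℤ) : 𝓞 K) ∈ w.asIdeal ∧ ((p : ℕ) : 𝓞 K) ∉ w.asIdeal))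
    (hna : ∀ (v : HeightOneSpectrum (𝓞 ℚ)), ((p : ℕ) : 𝓞 ℚ) ∈ v.asIdeal →
      ∀ (Φ : AddSubgroup (geomTorsion W (p : ℤ))), Nat.card Φ = p →
      ∀ 𝔓 ∈ v.primesAbove,
        (¬ ∀ g ∈ 𝔓.decompositionSubgroup (absoluteGaloisGroup ℚ), ∀ P ∈ Φ, g • P = P) ∧
          (¬ ∀ g ∈ 𝔓.decompositionSubgroup (absoluteGaloisGroup ℚ),
            ∀ P : geomTorsion W (p : ℤ), g • P - P ∈ Φ))
    (θsub θquot : FramedGaloisRep K (padicCoeffIntegers (∅ : Set (PadicAlgCl p))) 1)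
    (hpair : IsResidualPairOver (W.baseChange K) p θsub θquot)
    (Dsub : GrDualData κ (charModule (∅ : Set (PadicAlgCl p)) θsub) vbar (↑Sf : Set (HeightOneSpectrum (𝓞 K))) γ)
    (Dquot : GrDualData κ (charModule (∅ : Set (PadicAlgCl p)) θquot) vbar (↑Sf : Set (HeightOneSpectrum (𝓞 K))) γ) :
    p ^ lambdaInvariant p (XAc (W.baseChange K) p κ vbar (↑Sf : Set (HeightOneSpectrum (𝓞 K))) γ) *
          Nat.card {x : XAc (W.baseChange K) p κ vbar (↑Sf : Set (HeightOneSpectrum (𝓞 K))) γ // p • x = 0} =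
        p ^ (lambdaInvariant p Dsub.X + lambdaInvariant p Dquot.X) ∧
      lambdaInvariant p (XAc (W.baseChange K) p κ vbar (↑Sf : Set (HeightOneSpectrum (𝓞 K))) γ) ≤
        lambdaInvariant p Dsub.X + lambdaInvariant p Dquot.X ∧
      ((∀ x : XAc (W.baseChange K) p κ vbar (↑Sf : Set (HeightOneSpectrum (𝓞 K))) γ, p • x = 0 → x = 0) →
        lambdaInvariant p (XAc (W.baseChange K) p κ vbar (↑Sf : Set (HeightOneSpectrum (𝓞 K))) γ) =
          lambdaInvariant p Dsub.X + lambdaInvariant p Dquot.X) := by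
  haveI hEK : (W.baseChange K).IsElliptic := inferInstanceAs (W.map (algebraMap ℚ K)).IsElliptic
  -- the residual pair's line and its local data at `v̄`
  obtain ⟨S, hSub, -, ⟨jsub, hjsub, hjsub_inj, hjsub_range⟩, ⟨jquot, hjquot, hjquot_inj, hjquot_range⟩⟩ :=
    ResidualPairStableLine.exists_stableLine_of_isResidualPairOver (W.baseChange K) hpair
  obtain ⟨-, hnon1, hnon2, hωS, hωQ, -⟩ := localData_of_nonAnomalous W K vbar κ hK hsplit hvbar hna S hSub
  -- in the currency of the character modules
  have hne1sub := fun h ↦ hnon1 ((forall_smul_eq_iff_of_embedding θsub jsub hjsub hjsub_inj hjsub_range (decomp vbar)).mpr h)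
  have hne1quot := fun h ↦ hnon2 ((forall_smul_eq_iff_of_embedding θquot jquot hjquot hjquot_inj hjquot_range (decomp vbar)).mpr h)
  have hneωsub := fun h ↦
    hωS ((forall_smul_eq_cyclotomic_iff_of_embedding θsub jsub hjsub hjsub_inj hjsub_range (decomp vbar)).mpr h)
  have hneωquot := fun h ↦
    hωQ ((forall_smul_eq_cyclotomic_iff_of_embedding θquot jquot hjquot hjquot_inj hjquot_range (decomp vbar)).mpr h)
  exact lambdaInvariant_le_add_of_isResidualPairOver hprop125 hlift hlocal W K vbar κ γ Sf hp2 hK hH hsplit hvbar hκ hSf θsub θquot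
    hpair hne1sub hneωsub hne1quot hneωquot Dsub Dquot

/-- **The λ-relation on the semistable-twist cells of B6 ∩ X3 at `p ≥ 5`** — §2 with `hna` from
`SemistableTwistLocalAnyLine.not_fix_and_not_quot_of_classX3_of_subSemistableTwist_of_card_eq`: for every globally minimal
`W/ℚ` with `ClassX3 W p ∧ SubSemistableTwist W p`, `5 ≤ p`, every Heegner `K` with `(p)` split, THE anticyclotomic `κ`,
EVERY residual pair of `E_K[p]` and all strict dual data: the count, `λ(𝔛^{Sf}) ≤ λ(𝔛_sub) + λ(𝔛_quot)`, `=` if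
`𝔛^{Sf}[p] = 0` — modulo CGLS22 Prop. 1.2.5 + Cor. 1.2.6 [PUB] only.
[cite: KellerYin2024b, §3.5 first paragraph "exactly as in [KY24]" (arXiv:2410.23241 p. 20) (preprint; derived at p ≥ 5)]
[cite: KellerYin2024, Thm. 1.4.1 (arXiv:2402.12781v2 TeX L1087–1098)]
[cite: CastellaGrossiLeeSkinner2022, §1.2 Prop. 1.2.5, Cor. 1.2.6, §1.4 Props. 1.4.1–1.4.2 (e-print TeX L681–905)] -/
theorem lambdaInvariant_le_add_of_isResidualPairOver_of_classX3_of_subSemistableTwist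
    (hprop125 : prop125_characterGrSelmerDual_torsion_muZero_dim)
    (hlift : cor126_residualCharacter_globalLift) (hlocal : cor126_residualCharacter_localSurjective)
    {p : ℕ} [Fact p.Prime] (W : WeierstrassCurve ℚ) [W.IsElliptic] [W.IsGloballyMinimal]
    (K : Type) [Field K] [NumberField K] (vbar : HeightOneSpectrum (𝓞 K))
    (κ : ZpExtension K p) (γ : absoluteGaloisGroup K) [Fact (κ.IsTopGenerator γ)]
    (Sf : Finset (HeightOneSpectrum (𝓞 K)))
    (hp5 : 5 ≤ p) (hX : ClassX3 W p) (hSST : SubSemistableTwist W p)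
    (hK : IsImaginaryQuadratic K) (hH : SatisfiesHeegnerHypothesis (W.conductorNorm ℤ) K)
    (hsplit : ((Ideal.span {(p : ℤ)}).primesOver (𝓞 K)).ncard = 2)
    (hvbar : ((p : ℕ) : 𝓞 K) ∈ vbar.asIdeal) (hκ : κ.IsAnticyclotomic)
    (hSf : ∀ w : HeightOneSpectrum (𝓞 K), w ∈ Sf ↔
      (((W.conductorNorm ℤ : ℤ) : 𝓞 K) ∈ w.asIdeal ∧ ((p : ℕ) : 𝓞 K) ∉ w.asIdeal))
    (θsub θquot : FramedGaloisRep K (padicCoeffIntegers (∅ : Set (PadicAlgCl p))) 1)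
    (hpair : IsResidualPairOver (W.baseChange K) p θsub θquot)
    (Dsub : GrDualData κ (charModule (∅ : Set (PadicAlgCl p)) θsub) vbar (↑Sf : Set (HeightOneSpectrum (𝓞 K))) γ)
    (Dquot : GrDualData κ (charModule (∅ : Set (PadicAlgCl p)) θquot) vbar (↑Sf : Set (HeightOneSpectrum (𝓞 K))) γ) :
    p ^ lambdaInvariant p (XAc (W.baseChange K) p κ vbar (↑Sf : Set (HeightOneSpectrum (𝓞 K))) γ) *
          Nat.card {x : XAc (W.baseChange K) p κ vbar (↑Sf : Set (HeightOneSpectrum (𝓞 K))) γ // p • x = 0} =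
        p ^ (lambdaInvariant p Dsub.X + lambdaInvariant p Dquot.X) ∧
      lambdaInvariant p (XAc (W.baseChange K) p κ vbar (↑Sf : Set (HeightOneSpectrum (𝓞 K))) γ) ≤
        lambdaInvariant p Dsub.X + lambdaInvariant p Dquot.X ∧
      ((∀ x : XAc (W.baseChange K) p κ vbar (↑Sf : Set (HeightOneSpectrum (𝓞 K))) γ, p • x = 0 → x = 0) →
        lambdaInvariant p (XAc (W.baseChange K) p κ vbar (↑Sf : Set (HeightOneSpectrum (𝓞 K))) γ) =
          lambdaInvariant p Dsub.X + lambdaInvariant p Dquot.X) :=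
  lambdaInvariant_le_add_of_isResidualPairOver_of_nonAnomalous hprop125 hlift hlocal W K vbar κ γ Sf (by omega) hK hH hsplit
    hvbar hκ hSf
    (fun _ hpv _ hΦ _ h𝔓 ↦
      SemistableTwistLocalAnyLine.not_fix_and_not_quot_of_classX3_of_subSemistableTwist_of_card_eq W p hp5 hX hSST hpv h𝔓 hΦ)
    θsub θquot hpair Dsub Dquot

end Summit.BirchSwinnertonDyer.BirchSwinnertonDyer.Theorems.SchneiderFreeAdditiveX3.KYLambdaAlg

end
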